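import Mathlib
import Summits.RiemannHypothesis.RiemannHypothesis.Theorems.WeilFormatCDeflatedFarRows
import HarnessLib

/-!
# Format C, design C∞: the `d̂`-weighted limit entries of the correction — existence, convergence, tail bounds

Route context: Fourier–Galerkin / Schur-complement certificates of Weil positivity on a window ("format C";
cell memo `run/shared/lean/pub/rh-explicit/rh-explicit-weil-10/KERNEL-LEVER.md` §18; supporting
stmt-RiemannHypothesis-0098; seat rh-explicit-weil-10).

The C∞ soundness theorem (`sum_range_mul_mul_nonneg_of_certificate_cinf`, `WeilFormatCDeflatedFarEnvelope`) takes the three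
`d̂`-weighted entry families of the rank-`r` correction as LIMITS: `A∞(j,j') = lim Σ_{m∈[B,P)} V(m,j)V(m,j')/d̂_m`,
`ρ∞(j,i) = lim Σ_m V(m,j)M(i,m)/d̂_m`, `σ∞(j,j'') = lim Σ_m V(m,j)c^P(m,j'')/d̂_m`.  Unlike the window-form entries these have no
closed form (`d̂` is piecewise data); this file shows, under the kernel envelope, the cube decay of the profiles and the floor
`d̂ ≥ d₀ > 0`, that they EXIST as absolutely convergent series, that the finite-`P` entries converge to them (the hypotheses
`hA`, `hρ`, `hσ` of the soundness theorem, with `A∞ := Σ'`, …), and EXPLICIT TAIL BOUNDS by which the (E) side encloses them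
from finitely many terms:

* `sum_Ico_eq_sum_range_ite`, `tendsto_sum_Ico_of_summable`, `summable_ite_of_le_div_sq`, `abs_tsum_sub_sum_Ico_le` —
  generic: partial sums over `[B,P)`, summability from `|f_m| ≤ c/m²`, and the tail `|Σ' − Σ_{[B,Q)}| ≤ 2c'/Q` when
  `|f_m| ≤ c'/m²` beyond `Q`;
* `tendsto_weightedGram` / `abs_weightedGram_tail_le` — `A`: terms `≤ K²/(d₀m⁶)`, tail `≤ 2K²/(d₀Q⁵)`;
* `tendsto_weightedBlock` / `abs_weightedBlock_tail_le` — `ρ`: terms `≤ KC₀B/(d₀m⁴)`, tail `≤ 2KC₀B/(d₀Q³)`;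
* `tendsto_weightedImage` / `abs_weightedImage_tail_le` — `σ`: with the LIMIT images `c∞` the terms are `≤ KL/(d₀m⁴)`
  (`L = (4C₀+2C₁+2C₂)K`), tail `≤ 2KL/(d₀Q³)`; and `tendsto_weightedImage_finite` — the entries with the FINITE images
  `c^P` have the same limit (their difference is `≤ 2KL/(d₀P)`).

Pure real analysis on sequences; standard axioms; nothing Weil-specific; no RH claim.
-/

-- `Summit.RiemannHypothesis.RiemannHypothesis.…` is the layout-mandated namespace (summit = problem name).
set_option linter.dupNamespace false

namespace Summit.RiemannHypothesis.RiemannHypothesis.Theorems.WeilFormatC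

open Finset Filter Topology

/-! ## Generic: partial sums over `[B, P)` and tails -/

/-- `Σ_{m∈[B,P)} f_m = Σ_{m<P} [B ≤ m] f_m`. -/
theorem sum_Ico_eq_sum_range_ite (f : ℕ → ℝ) (B P : ℕ) :
    ∑ m ∈ Ico B P, f m = ∑ m ∈ range P, (if B ≤ m then f m else 0) := by
  rw [← Finset.sum_filter]
  congr 1
  ext m
  simp only [Finset.mem_Ico, Finset.mem_filter, Finset.mem_range]
  omega

/-- Partial sums over `[B, P)` converge to the series of the `[B, ∞)`-restricted sequence when it is summable. -/
theorem tendsto_sum_Ico_of_summable {f : ℕ → ℝ} (B : ℕ) (hf : Summable fun m ↦ if B ≤ m then f m else 0) :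
    Tendsto (fun P ↦ ∑ m ∈ Ico B P, f m) atTop (𝓝 (∑' m, if B ≤ m then f m else 0)) := by
  have h := hf.hasSum.tendsto_sum_nat
  refine h.congr fun P ↦ ?_
  rw [sum_Ico_eq_sum_range_ite]

/-- Summability of the restricted sequence from a bound `|f_m| ≤ c/m²` on `[B, ∞)`, `B ≥ 1`, `c ≥ 0`. -/
theorem summable_ite_of_le_div_sq {f : ℕ → ℝ} {B : ℕ} {c : ℝ} (hc : 0 ≤ c)
    (h : ∀ m, B ≤ m → |f m| ≤ c / (m : ℝ) ^ 2) :
    Summable fun m ↦ if B ≤ m then f m else 0 := by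
  have hs : Summable fun m : ℕ ↦ c * (1 / (m : ℝ) ^ 2) :=
    ((Real.summable_one_div_nat_pow).2 (by norm_num)).mul_left c
  refine Summable.of_norm_bounded hs fun m ↦ ?_
  rw [Real.norm_eq_abs]
  split_ifs with hm
  · rw [mul_one_div]; exact h m hm
  · rw [abs_zero]; exact mul_nonneg hc (by positivity)

/-- **Generic tail bound**: if `|f_m| ≤ c'/m²` for `m ≥ Q` (`Q ≥ B ≥ 1`) and the restricted sequence is summable, then
`|Σ'_{m≥B} f_m − Σ_{m∈[B,Q)} f_m| ≤ 2c'/Q`. -/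
theorem abs_tsum_sub_sum_Ico_le {f : ℕ → ℝ} {B Q : ℕ} {c' : ℝ} (hB : 1 ≤ B) (hBQ : B ≤ Q)
    (hf : Summable fun m ↦ if B ≤ m then f m else 0)
    (h : ∀ m, Q ≤ m → |f m| ≤ c' / (m : ℝ) ^ 2) :
    |(∑' m, if B ≤ m then f m else 0) - ∑ m ∈ Ico B Q, f m| ≤ 2 * c' / (Q : ℝ) := by
  have hQ : 1 ≤ Q := hB.trans hBQ
  have hlim := (tendsto_sum_Ico_of_summable B hf).sub_const (∑ m ∈ Ico B Q, f m)
  refine le_of_tendsto hlim.abs ?_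
  filter_upwards [eventually_ge_atTop Q] with P hQP
  rw [← Finset.sum_Ico_consecutive _ hBQ hQP, add_sub_cancel_left]
  calc |∑ m ∈ Ico Q P, f m| ≤ ∑ m ∈ Ico Q P, |f m| := Finset.abs_sum_le_sum_abs _ _
    _ ≤ ∑ m ∈ Ico Q P, c' * (1 / (m : ℝ) ^ 2) := Finset.sum_le_sum fun m hm ↦ by
        rw [mul_one_div]; exact h m (Finset.mem_Ico.1 hm).1
    _ = c' * ∑ m ∈ Ico Q P, 1 / (m : ℝ) ^ 2 := by rw [Finset.mul_sum]
    _ ≤ c' * (2 / (Q : ℝ)) := by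
        have hc' : 0 ≤ c' := by
          have := h Q le_rfl
          have hQ0 : (0 : ℝ) < Q := by exact_mod_cast hQ
          have h0 : 0 ≤ c' / (Q : ℝ) ^ 2 := (abs_nonneg _).trans this
          have := mul_nonneg h0 (by positivity : (0 : ℝ) ≤ (Q : ℝ) ^ 2)
          rwa [div_mul_cancel₀ _ (by positivity)] at this
        exact mul_le_mul_of_nonneg_left (sum_Ico_inv_sq_le_two_div hQ P) hc'
    _ = 2 * c' / (Q : ℝ) := by ring

/-- Powers dominate squares: `c/m^(k+2) ≤ (c/Q^k)/m²` for `m ≥ Q ≥ 1`, `c ≥ 0`. -/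
theorem div_pow_le_div_div_sq {c : ℝ} (hc : 0 ≤ c) {Q m : ℕ} (hQ : 1 ≤ Q) (hQm : Q ≤ m) (k : ℕ) :
    c / (m : ℝ) ^ (k + 2) ≤ c / (Q : ℝ) ^ k / (m : ℝ) ^ 2 := by
  have hQ0 : (0 : ℝ) < Q := by exact_mod_cast hQ
  have hm0 : (0 : ℝ) < m := by exact_mod_cast hQ.trans hQm
  have hQm' : (Q : ℝ) ≤ m := by exact_mod_cast hQm
  rw [div_div, pow_add, div_le_div_iff₀ (by positivity) (by positivity)]
  refine mul_le_mul_of_nonneg_left ?_ hc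
  exact mul_le_mul_of_nonneg_right (pow_le_pow_left₀ hQ0.le hQm' k) (by positivity)

/-! ## The three weighted entry families -/

section Entries

variable {M : ℕ → ℕ → ℝ} {B r : ℕ} {V : ℕ → Fin r → ℝ} {dhat : ℕ → ℝ} {d₀ C₀ C₁ C₂ K : ℝ} {cinf : ℕ → Fin r → ℝ}

/-- `1/d̂_m ≤ 1/d₀` on the far range, as a bound on weighted terms: `|u v / d̂_m| ≤ |u||v|/d₀`. -/
theorem abs_mul_div_dhat_le (hd₀ : 0 < d₀) (hd : ∀ m, B ≤ m → d₀ ≤ dhat m) {m : ℕ} (hm : B ≤ m) (u v : ℝ) :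
    |u * v / dhat m| ≤ |u| * |v| / d₀ := by
  have hdm : d₀ ≤ dhat m := hd m hm
  have hdm0 : 0 < dhat m := lt_of_lt_of_le hd₀ hdm
  rw [abs_div, abs_mul, abs_of_pos hdm0]
  exact div_le_div_of_nonneg_left (by positivity) hd₀ hdm

/-- **`A`-terms**: `|V(m,j)V(m,j')/d̂_m| ≤ K²/(d₀ m⁶)` for `m ≥ B ≥ 1`. -/
theorem abs_weightedGram_term_le (hB : 1 ≤ B) (hd₀ : 0 < d₀) (hK : 0 ≤ K) (hd : ∀ m, B ≤ m → d₀ ≤ dhat m)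
    (hV : ∀ n j, B ≤ n → |V n j| ≤ K / (n : ℝ) ^ 3) {m : ℕ} (hm : B ≤ m) (j j' : Fin r) :
    |V m j * V m j' / dhat m| ≤ K ^ 2 / d₀ / (m : ℝ) ^ 6 := by
  have hm0 : (0 : ℝ) < m := by exact_mod_cast hB.trans hm
  refine (abs_mul_div_dhat_le hd₀ hd hm _ _).trans ?_
  calc |V m j| * |V m j'| / d₀ ≤ (K / (m : ℝ) ^ 3) * (K / (m : ℝ) ^ 3) / d₀ :=
        div_le_div_of_nonneg_right (mul_le_mul (hV m j hm) (hV m j' hm) (abs_nonneg _) (by positivity)) hd₀.le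
    _ = K ^ 2 / d₀ / (m : ℝ) ^ 6 := by field_simp

/-- **`A∞` exists and is the limit**: `Σ_{m∈[B,P)} V(m,j)V(m,j')/d̂_m → Σ'_{m≥B} V(m,j)V(m,j')/d̂_m`. -/
theorem tendsto_weightedGram (hB : 1 ≤ B) (hd₀ : 0 < d₀) (hK : 0 ≤ K) (hd : ∀ m, B ≤ m → d₀ ≤ dhat m)
    (hV : ∀ n j, B ≤ n → |V n j| ≤ K / (n : ℝ) ^ 3) (j j' : Fin r) :
    Tendsto (fun P ↦ ∑ m ∈ Ico B P, V m j * V m j' / dhat m) atTop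
      (𝓝 (∑' m, if B ≤ m then V m j * V m j' / dhat m else 0)) := by
  refine tendsto_sum_Ico_of_summable B (summable_ite_of_le_div_sq (by positivity : 0 ≤ K ^ 2 / d₀) fun m hm ↦ ?_)
  refine (abs_weightedGram_term_le hB hd₀ hK hd hV hm j j').trans ?_
  have h := div_pow_le_div_div_sq (by positivity : 0 ≤ K ^ 2 / d₀) hB hm 4
  have hB1 : (1 : ℝ) ≤ B := by exact_mod_cast hB
  refine h.trans (div_le_div_of_nonneg_right (div_le_self (by positivity) (one_le_pow₀ hB1)) (by positivity))

/-- **Tail of `A∞`**: `|A∞(j,j') − Σ_{m∈[B,Q)} V(m,j)V(m,j')/d̂_m| ≤ 2K²/(d₀Q⁵)` (`Q ≥ B ≥ 1`). -/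
theorem abs_weightedGram_tail_le (hB : 1 ≤ B) (hd₀ : 0 < d₀) (hK : 0 ≤ K) (hd : ∀ m, B ≤ m → d₀ ≤ dhat m)
    (hV : ∀ n j, B ≤ n → |V n j| ≤ K / (n : ℝ) ^ 3) (j j' : Fin r) {Q : ℕ} (hBQ : B ≤ Q) :
    |(∑' m, if B ≤ m then V m j * V m j' / dhat m else 0) - ∑ m ∈ Ico B Q, V m j * V m j' / dhat m|
      ≤ 2 * (K ^ 2 / d₀ / (Q : ℝ) ^ 4) / (Q : ℝ) := by
  have hQ : 1 ≤ Q := hB.trans hBQ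
  refine abs_tsum_sub_sum_Ico_le hB hBQ (summable_ite_of_le_div_sq (by positivity : 0 ≤ K ^ 2 / d₀) fun m hm ↦ ?_)
    fun m hm ↦ ?_
  · refine (abs_weightedGram_term_le hB hd₀ hK hd hV hm j j').trans ?_
    have h := div_pow_le_div_div_sq (by positivity : 0 ≤ K ^ 2 / d₀) hB hm 4
    have hB1 : (1 : ℝ) ≤ B := by exact_mod_cast hB
    exact h.trans (div_le_div_of_nonneg_right (div_le_self (by positivity) (one_le_pow₀ hB1)) (by positivity))
  · exact (abs_weightedGram_term_le hB hd₀ hK hd hV (hBQ.trans hm) j j').trans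
      (div_pow_le_div_div_sq (by positivity) hQ hm 4)

/-- **`ρ`-terms**: `|V(m,j)M(i,m)/d̂_m| ≤ KC₀B/(d₀ m⁴)` for `i < B ≤ m`. -/
theorem abs_weightedBlock_term_le (hB : 1 ≤ B) (hd₀ : 0 < d₀) (hC₀ : 0 ≤ C₀) (hK : 0 ≤ K)
    (hd : ∀ m, B ≤ m → d₀ ≤ dhat m) (hoff : ∀ n m, n ≠ m → |M n m| ≤ C₀ / |(n : ℝ) - m|)
    (hV : ∀ n j, B ≤ n → |V n j| ≤ K / (n : ℝ) ^ 3) {m : ℕ} (hm : B ≤ m) (j : Fin r) (i : Fin B) :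
    |V m j * M i m / dhat m| ≤ K * C₀ * B / d₀ / (m : ℝ) ^ 4 := by
  have hm0 : (0 : ℝ) < m := by exact_mod_cast hB.trans hm
  refine (abs_mul_div_dhat_le hd₀ hd hm _ _).trans ?_
  calc |V m j| * |M i m| / d₀ ≤ (K / (m : ℝ) ^ 3) * (C₀ * B / (m : ℝ)) / d₀ :=
        div_le_div_of_nonneg_right
          (mul_le_mul (hV m j hm) (abs_block_row_le hC₀ hoff i.isLt hm) (abs_nonneg _) (by positivity)) hd₀.le
    _ = K * C₀ * B / d₀ / (m : ℝ) ^ 4 := by field_simp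

/-- **`ρ∞` exists and is the limit**: `Σ_{m∈[B,P)} V(m,j)M(i,m)/d̂_m → Σ'_{m≥B} V(m,j)M(i,m)/d̂_m` (`i < B`). -/
theorem tendsto_weightedBlock (hB : 1 ≤ B) (hd₀ : 0 < d₀) (hC₀ : 0 ≤ C₀) (hK : 0 ≤ K)
    (hd : ∀ m, B ≤ m → d₀ ≤ dhat m) (hoff : ∀ n m, n ≠ m → |M n m| ≤ C₀ / |(n : ℝ) - m|)
    (hV : ∀ n j, B ≤ n → |V n j| ≤ K / (n : ℝ) ^ 3) (j : Fin r) (i : Fin B) :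
    Tendsto (fun P ↦ ∑ m ∈ Ico B P, V m j * M i m / dhat m) atTop
      (𝓝 (∑' m, if B ≤ m then V m j * M i m / dhat m else 0)) := by
  refine tendsto_sum_Ico_of_summable B
    (summable_ite_of_le_div_sq (by positivity : 0 ≤ K * C₀ * B / d₀) fun m hm ↦ ?_)
  refine (abs_weightedBlock_term_le hB hd₀ hC₀ hK hd hoff hV hm j i).trans ?_
  have h := div_pow_le_div_div_sq (by positivity : 0 ≤ K * C₀ * B / d₀) hB hm 2
  have hB1 : (1 : ℝ) ≤ B := by exact_mod_cast hB
  exact h.trans (div_le_div_of_nonneg_right (div_le_self (by positivity) (one_le_pow₀ hB1)) (by positivity))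

/-- **Tail of `ρ∞`**: `|ρ∞(j,i) − Σ_{m∈[B,Q)} V(m,j)M(i,m)/d̂_m| ≤ 2KC₀B/(d₀Q³)` (`Q ≥ B ≥ 1`). -/
theorem abs_weightedBlock_tail_le (hB : 1 ≤ B) (hd₀ : 0 < d₀) (hC₀ : 0 ≤ C₀) (hK : 0 ≤ K)
    (hd : ∀ m, B ≤ m → d₀ ≤ dhat m) (hoff : ∀ n m, n ≠ m → |M n m| ≤ C₀ / |(n : ℝ) - m|)
    (hV : ∀ n j, B ≤ n → |V n j| ≤ K / (n : ℝ) ^ 3) (j : Fin r) (i : Fin B) {Q : ℕ} (hBQ : B ≤ Q) :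
    |(∑' m, if B ≤ m then V m j * M i m / dhat m else 0) - ∑ m ∈ Ico B Q, V m j * M i m / dhat m|
      ≤ 2 * (K * C₀ * B / d₀ / (Q : ℝ) ^ 2) / (Q : ℝ) := by
  have hQ : 1 ≤ Q := hB.trans hBQ
  refine abs_tsum_sub_sum_Ico_le hB hBQ
    (summable_ite_of_le_div_sq (by positivity : 0 ≤ K * C₀ * B / d₀) fun m hm ↦ ?_) fun m hm ↦ ?_
  · refine (abs_weightedBlock_term_le hB hd₀ hC₀ hK hd hoff hV hm j i).trans ?_
    have h := div_pow_le_div_div_sq (by positivity : 0 ≤ K * C₀ * B / d₀) hB hm 2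
    have hB1 : (1 : ℝ) ≤ B := by exact_mod_cast hB
    exact h.trans (div_le_div_of_nonneg_right (div_le_self (by positivity) (one_le_pow₀ hB1)) (by positivity))
  · exact (abs_weightedBlock_term_le hB hd₀ hC₀ hK hd hoff hV (hBQ.trans hm) j i).trans
      (div_pow_le_div_div_sq (by positivity) hQ hm 2)

/-- **`σ`-terms with the limit images**: `|V(m,j)c∞(m,j'')/d̂_m| ≤ KL/(d₀ m⁴)`, `L = (4C₀+2C₁+2C₂)K` (`m ≥ B ≥ 1`). -/
theorem abs_weightedImage_term_le (hB : 1 ≤ B) (hd₀ : 0 < d₀) (hC₀ : 0 ≤ C₀) (hC₁ : 0 ≤ C₁) (hC₂ : 0 ≤ C₂) (hK : 0 ≤ K)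
    (hd : ∀ m, B ≤ m → d₀ ≤ dhat m) (hoff : ∀ n m, n ≠ m → |M n m| ≤ C₀ / |(n : ℝ) - m|)
    (hdiag : ∀ n, |M n n| ≤ C₁ + C₂ * Real.log (1 + n))
    (hV : ∀ n j, B ≤ n → |V n j| ≤ K / (n : ℝ) ^ 3)
    (hc : ∀ m j, B ≤ m → Tendsto (fun P ↦ ∑ n ∈ Ico B P, M n m * V n j) atTop (𝓝 (cinf m j)))
    {m : ℕ} (hm : B ≤ m) (j j'' : Fin r) :
    |V m j * cinf m j'' / dhat m| ≤ K * ((4 * C₀ + 2 * C₁ + 2 * C₂) * K) / d₀ / (m : ℝ) ^ 4 := by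
  have hm1 : 1 ≤ m := hB.trans hm
  have hm0 : (0 : ℝ) < m := by exact_mod_cast hm1
  refine (abs_mul_div_dhat_le hd₀ hd hm _ _).trans ?_
  have hci := abs_cinf_le hC₀ hC₁ hC₂ hK hB hoff hdiag hV hm1 (hc m j'' hm)
  calc |V m j| * |cinf m j''| / d₀ ≤ (K / (m : ℝ) ^ 3) * ((4 * C₀ + 2 * C₁ + 2 * C₂) * K / (m : ℝ)) / d₀ :=
        div_le_div_of_nonneg_right (mul_le_mul (hV m j hm) hci (abs_nonneg _) (by positivity)) hd₀.le
    _ = K * ((4 * C₀ + 2 * C₁ + 2 * C₂) * K) / d₀ / (m : ℝ) ^ 4 := by field_simp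

/-- **`σ∞` exists and is the limit of the entries with the LIMIT images**:
`Σ_{m∈[B,P)} V(m,j)c∞(m,j'')/d̂_m → σ∞(j,j'') := Σ'_{m≥B} V(m,j)c∞(m,j'')/d̂_m`. -/
theorem tendsto_weightedImage (hB : 1 ≤ B) (hd₀ : 0 < d₀) (hC₀ : 0 ≤ C₀) (hC₁ : 0 ≤ C₁) (hC₂ : 0 ≤ C₂) (hK : 0 ≤ K)
    (hd : ∀ m, B ≤ m → d₀ ≤ dhat m) (hoff : ∀ n m, n ≠ m → |M n m| ≤ C₀ / |(n : ℝ) - m|)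
    (hdiag : ∀ n, |M n n| ≤ C₁ + C₂ * Real.log (1 + n))
    (hV : ∀ n j, B ≤ n → |V n j| ≤ K / (n : ℝ) ^ 3)
    (hc : ∀ m j, B ≤ m → Tendsto (fun P ↦ ∑ n ∈ Ico B P, M n m * V n j) atTop (𝓝 (cinf m j)))
    (j j'' : Fin r) :
    Tendsto (fun P ↦ ∑ m ∈ Ico B P, V m j * cinf m j'' / dhat m) atTop
      (𝓝 (∑' m, if B ≤ m then V m j * cinf m j'' / dhat m else 0)) := by
  refine tendsto_sum_Ico_of_summable B
    (summable_ite_of_le_div_sq (by positivity : 0 ≤ K * ((4 * C₀ + 2 * C₁ + 2 * C₂) * K) / d₀) fun m hm ↦ ?_)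
  refine (abs_weightedImage_term_le hB hd₀ hC₀ hC₁ hC₂ hK hd hoff hdiag hV hc hm j j'').trans ?_
  have h := div_pow_le_div_div_sq (by positivity : 0 ≤ K * ((4 * C₀ + 2 * C₁ + 2 * C₂) * K) / d₀) hB hm 2
  have hB1 : (1 : ℝ) ≤ B := by exact_mod_cast hB
  exact h.trans (div_le_div_of_nonneg_right (div_le_self (by positivity) (one_le_pow₀ hB1)) (by positivity))

/-- **Tail of `σ∞`**: `|σ∞(j,j'') − Σ_{m∈[B,Q)} V(m,j)c∞(m,j'')/d̂_m| ≤ 2KL/(d₀Q³)` (`Q ≥ B ≥ 1`). -/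
theorem abs_weightedImage_tail_le (hB : 1 ≤ B) (hd₀ : 0 < d₀) (hC₀ : 0 ≤ C₀) (hC₁ : 0 ≤ C₁) (hC₂ : 0 ≤ C₂)
    (hK : 0 ≤ K) (hd : ∀ m, B ≤ m → d₀ ≤ dhat m) (hoff : ∀ n m, n ≠ m → |M n m| ≤ C₀ / |(n : ℝ) - m|)
    (hdiag : ∀ n, |M n n| ≤ C₁ + C₂ * Real.log (1 + n))
    (hV : ∀ n j, B ≤ n → |V n j| ≤ K / (n : ℝ) ^ 3)
    (hc : ∀ m j, B ≤ m → Tendsto (fun P ↦ ∑ n ∈ Ico B P, M n m * V n j) atTop (𝓝 (cinf m j)))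
    (j j'' : Fin r) {Q : ℕ} (hBQ : B ≤ Q) :
    |(∑' m, if B ≤ m then V m j * cinf m j'' / dhat m else 0) - ∑ m ∈ Ico B Q, V m j * cinf m j'' / dhat m|
      ≤ 2 * (K * ((4 * C₀ + 2 * C₁ + 2 * C₂) * K) / d₀ / (Q : ℝ) ^ 2) / (Q : ℝ) := by
  have hQ : 1 ≤ Q := hB.trans hBQ
  refine abs_tsum_sub_sum_Ico_le hB hBQ
    (summable_ite_of_le_div_sq (by positivity : 0 ≤ K * ((4 * C₀ + 2 * C₁ + 2 * C₂) * K) / d₀) fun m hm ↦ ?_)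
    fun m hm ↦ ?_
  · refine (abs_weightedImage_term_le hB hd₀ hC₀ hC₁ hC₂ hK hd hoff hdiag hV hc hm j j'').trans ?_
    have h := div_pow_le_div_div_sq (by positivity : 0 ≤ K * ((4 * C₀ + 2 * C₁ + 2 * C₂) * K) / d₀) hB hm 2
    have hB1 : (1 : ℝ) ≤ B := by exact_mod_cast hB
    exact h.trans (div_le_div_of_nonneg_right (div_le_self (by positivity) (one_le_pow₀ hB1)) (by positivity))
  · exact (abs_weightedImage_term_le hB hd₀ hC₀ hC₁ hC₂ hK hd hoff hdiag hV hc (hBQ.trans hm) j j'').trans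
      (div_pow_le_div_div_sq (by positivity) hQ hm 2)

/-- **The entries with the FINITE images have the same limit**: `Σ_{m∈[B,P)} V(m,j)c^P(m,j'')/d̂_m → σ∞(j,j'')`
(`c^P(m,j'') = Σ_{n∈[B,P)} M(n,m)V(n,j'')`; the difference to the entries with `c∞` is `≤ 2KL/(d₀P)`). -/
theorem tendsto_weightedImage_finite (hB : 1 ≤ B) (hd₀ : 0 < d₀) (hC₀ : 0 ≤ C₀) (hC₁ : 0 ≤ C₁) (hC₂ : 0 ≤ C₂)
    (hK : 0 ≤ K) (hd : ∀ m, B ≤ m → d₀ ≤ dhat m) (hoff : ∀ n m, n ≠ m → |M n m| ≤ C₀ / |(n : ℝ) - m|)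
    (hdiag : ∀ n, |M n n| ≤ C₁ + C₂ * Real.log (1 + n))
    (hV : ∀ n j, B ≤ n → |V n j| ≤ K / (n : ℝ) ^ 3)
    (hc : ∀ m j, B ≤ m → Tendsto (fun P ↦ ∑ n ∈ Ico B P, M n m * V n j) atTop (𝓝 (cinf m j)))
    (j j'' : Fin r) :
    Tendsto (fun P ↦ ∑ m ∈ Ico B P, V m j * (∑ n ∈ Ico B P, M n m * V n j'') / dhat m) atTop
      (𝓝 (∑' m, if B ≤ m then V m j * cinf m j'' / dhat m else 0)) := by
  set L : ℝ := (4 * C₀ + 2 * C₁ + 2 * C₂) * K with hL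
  have hlim := tendsto_weightedImage hB hd₀ hC₀ hC₁ hC₂ hK hd hoff hdiag hV hc j j''
  -- the difference tends to zero
  have hdiff : Tendsto (fun P ↦ (∑ m ∈ Ico B P, V m j * (∑ n ∈ Ico B P, M n m * V n j'') / dhat m)
      - ∑ m ∈ Ico B P, V m j * cinf m j'' / dhat m) atTop (𝓝 0) := by
    have hbound : ∀ P, B ≤ P → |(∑ m ∈ Ico B P, V m j * (∑ n ∈ Ico B P, M n m * V n j'') / dhat m)
        - ∑ m ∈ Ico B P, V m j * cinf m j'' / dhat m| ≤ 2 * (K * L / d₀) / (P : ℝ) := by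
      intro P hBP
      have hP0 : (0 : ℝ) < P := by exact_mod_cast hB.trans hBP
      rw [← Finset.sum_sub_distrib]
      calc |∑ m ∈ Ico B P, (V m j * (∑ n ∈ Ico B P, M n m * V n j'') / dhat m - V m j * cinf m j'' / dhat m)|
          ≤ ∑ m ∈ Ico B P, |V m j * (∑ n ∈ Ico B P, M n m * V n j'') / dhat m - V m j * cinf m j'' / dhat m| :=
            Finset.abs_sum_le_sum_abs _ _
        _ ≤ ∑ m ∈ Ico B P, (K * L / (d₀ * P)) * (1 / (m : ℝ) ^ 2) := Finset.sum_le_sum fun m hm ↦ by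
            have hBm : B ≤ m := (Finset.mem_Ico.1 hm).1
            have hm1 : 1 ≤ m := hB.trans hBm
            have hm0 : (0 : ℝ) < m := by exact_mod_cast hm1
            have e : V m j * (∑ n ∈ Ico B P, M n m * V n j'') / dhat m - V m j * cinf m j'' / dhat m
                = V m j * ((∑ n ∈ Ico B P, M n m * V n j'') - cinf m j'') / dhat m := by ring
            rw [e]
            refine (abs_mul_div_dhat_le hd₀ hd hBm _ _).trans ?_
            have h1 := hV m j hBm
            have h2 : |(∑ n ∈ Ico B P, M n m * V n j'') - cinf m j''| ≤ L / ((m : ℝ) * P) := by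
              rw [abs_sub_comm]
              exact abs_cinf_sub_le hC₀ hC₁ hC₂ hK hB hoff hdiag hV hm1 (hc m j'' hBm) hBP
            calc |V m j| * |(∑ n ∈ Ico B P, M n m * V n j'') - cinf m j''| / d₀
                ≤ (K / (m : ℝ) ^ 3) * (L / ((m : ℝ) * P)) / d₀ :=
                  div_le_div_of_nonneg_right (mul_le_mul h1 h2 (abs_nonneg _) (by positivity)) hd₀.le
              _ = (K * L / (d₀ * P)) * (1 / (m : ℝ) ^ 4) := by field_simp
              _ ≤ (K * L / (d₀ * P)) * (1 / (m : ℝ) ^ 2) := by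
                  refine mul_le_mul_of_nonneg_left ?_ (by positivity)
                  have hm1' : (1 : ℝ) ≤ m := by exact_mod_cast hm1
                  exact one_div_le_one_div_of_le (by positivity) (pow_le_pow_right₀ hm1' (by norm_num))
        _ = (K * L / (d₀ * P)) * ∑ m ∈ Ico B P, 1 / (m : ℝ) ^ 2 := by rw [Finset.mul_sum]
        _ ≤ (K * L / (d₀ * P)) * (2 / (B : ℝ)) :=
            mul_le_mul_of_nonneg_left (sum_Ico_inv_sq_le_two_div hB P) (by positivity)
        _ ≤ 2 * (K * L / d₀) / (P : ℝ) := by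
            have hB1 : (1 : ℝ) ≤ B := by exact_mod_cast hB
            have h2B : 2 / (B : ℝ) ≤ 2 := div_le_self (by norm_num) hB1
            calc (K * L / (d₀ * P)) * (2 / (B : ℝ)) ≤ (K * L / (d₀ * P)) * 2 :=
                  mul_le_mul_of_nonneg_left h2B (by positivity)
              _ = 2 * (K * L / d₀) / (P : ℝ) := by field_simp
    have hrate : Tendsto (fun P : ℕ ↦ 2 * (K * L / d₀) / (P : ℝ)) atTop (𝓝 0) :=
      tendsto_const_nhds.div_atTop tendsto_natCast_atTop_atTop
    refine squeeze_zero_norm' ?_ hrate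
    filter_upwards [eventually_ge_atTop B] with P hP
    rw [Real.norm_eq_abs]
    exact hbound P hP
  have := hlim.add hdiff
  rw [add_zero] at this
  exact this.congr fun P ↦ by ring

end Entries

end Summit.RiemannHypothesis.RiemannHypothesis.Theorems.WeilFormatC
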